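import Summits.ResolutionOfSingularities.ResolutionOfSingularities.Theorems.FrobeniusClosingPatchingRelPerfectDepthTargetsR5H
import Summits.ResolutionOfSingularities.ResolutionOfSingularities.Theorems.FrobeniusClosingPatchingRelPerfectDepthHLedInitialTools
import Summits.ResolutionOfSingularities.ResolutionOfSingularities.Theorems.FrobeniusClosingPatchingRelPerfectDepthTaylorInitialHost
import Summits.ResolutionOfSingularities.ResolutionOfSingularities.Theorems.FrobeniusClosingPatchingRelPerfectDepthFlagDetectsOrder
import Summits.ResolutionOfSingularities.ResolutionOfSingularities.Theorems.FrobeniusClosingPatchingRelPerfectDepthLegalHSHypersurface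
import Summits.ResolutionOfSingularities.ResolutionOfSingularities.Theorems.EquisingularLiftEquisingularLiftNatRegularOfSpecialFibre
import Literature.AlgebraicGeometry.Resolution.ExcellentRingsCompleteHolds
import Literature.AlgebraicGeometry.Resolution.CofinalityFromPrincipalization
import Literature.AlgebraicGeometry.Resolution.SigmaMaxEliminationInDim
import Literature.AlgebraicGeometry.Resolution.BirationalDimensionInequality
import Literature.AlgebraicGeometry.Resolution.GenericFibreResolutionDatum
import Literature.AlgebraicGeometry.Resolution.ResolutionOfComponentsRegularLocus
import Literature.AlgebraicGeometry.Resolution.BlowupsIntegral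
import Literature.AlgebraicGeometry.Resolution.BlowupsScaling
import Literature.AlgebraicGeometry.Resolution.AffineBlowupUnique
import HarnessLib

/-!
# `PatchingRelPerfect` (stmt-ResolutionOfSingularities-16161), chain W5.2 — rung R5ᴴ, N1: the INITIAL hypersurface-led package
# `hLedInitial : HLedInitial`

[OURS · L1 W5.2 · res-D-pv-055, owner of R5ᴴ (plan-1 RULING G10-2/G10-3)] The first of the three targets of the rung
`hLedMemberI_atomConclusion_of_targets` (T-R5Hb, p537938): for `S` complete regular local of dimension four with a coefficient field
`σ`, `x` a regular system of parameters, a one-form member `I = (f) + (x_k^{d+ℓ})`, `f = σP₀(x) + σP₁(x) + G` (`P₀ ≠ 0` a form of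
degree `d ≥ 1`, `P₁` a form of degree `d + 1`, `G ∈ 𝔪^{d+2}`, `(f)` prime, `ℓ ≥ 1`) satisfying the hypersurface-led condition, the
member ideal has an `HLedPackage`. THE PACKAGE: `X = Bl_𝔪 Spec S` (`affineBlowup`, `g = π`), `𝓘_E = 𝔪𝒪_X`, the carrier
`W = V(𝓗)`, `𝓗 = ((f)𝒪_X : 𝓘_Eᵈ)` the strict transform of `V(f)` (an effective Cartier divisor, `𝓘_Eᵈ · 𝓗 = (f)𝒪_X` with `f ≠ 0`),
boundary `[(𝓘_E, ℓ)]`, FORMAT `I𝒪_X = 𝓘_Eᵈ · (𝓗 ⊔ 𝓘_E^ℓ)` (the constructions of `taylorPackageTwo(_single)`, `…DepthTaylorInitial(Host)`).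
What is new here:

* `W` is REGULAR: at a point of `W` over the closed point, i.e. on `E ≅ ℙ³` (`i_E ≫ r₀ = 𝟙`), the coefficient flag of
  `K = 𝓗 ⊔ 𝓘_E²` is `(𝓟(P₀), 𝓟(P₀) ⊔ 𝓟(P₁))` (`DepthOne.coeffFlag_residual_eq`), so the hypersurface-led condition
  (`ord_e 𝓟(P₀) ≤ 1 ∨ ord_e 𝓟(P₁) = 0`) says `ord_e (coeffFlag 0 K ⊔ (coeffFlag 1 K)²) ≤ 1`, whence the local equation of `𝓗` is a
  regular parameter (`DepthFlag.exists_generator_host_not_mem_sq_of_flag`, Kawanoue–Matsuki §2) and `𝒪_X/𝓗` is regular there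
  (Matsumura 14.2); regularity spreads from the special fibre because `W → Spec S` is proper
  (`Scheme.isRegular_subscheme_of_forall_over_closedPoint`, res-type-032's lemma);
* `𝓘_E|_W` is an effective Cartier divisor: `𝓗|_E = 𝓟(P₀)` is a non-zero locally principal ideal of the integral `E`, hence Cartier,
  and two Cartier divisors restrict to each other (`isEffectiveCartier_comap_subschemeι_swap`); it is `≠ ⊤` because the non-empty
  proper `S`-scheme `W` has a point over the closed point;
* `W` is INTEGRAL of DIMENSION THREE: by the restriction property of blow-ups with exponent `d`
  (`IsBlowup.isBlowup_subscheme_of_pow_mul_eq`) `W → Spec (S ⧸ (f))` is the blow-up of the integral three-dimensional `Spec (S ⧸ (f))`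
  along the non-zero `𝔪~|` (`IsBlowup.isIntegral`, `IsBirational.topologicalKrullDim_eq_of_isProper`);
* `W` is EXCELLENT: of finite type over the complete, hence excellent, `S` (`isExcellentRing_of_isAdicComplete`, Stacks 07QW).

Honest framing: OURS (AI-written, weaker than expert review); a rung tool of our own route; nothing here is a statement of the
manuscript under review.

## Sources
* H. Kawanoue, K. Matsuki (2016), §2 (the flag detects order two). [KawanoueMatsuki2016]
* H. Matsumura, *Commutative Ring Theory* (1987), Thm. 14.2, Thm. 17.10. [Matsumura1987]
* J. Kollár, *Lectures on Resolution of Singularities* (2007), (3.111) Step 3. [Kollar2007]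
* E. Bierstone, D. Grigoriev, P. Milman, J. Włodarczyk (2011), §4 Remark (3). [BierstoneGrigorievMilmanWlodarczyk2011]
* The Stacks Project, Tags 02ND, 02OS, 07QW. [StacksProject]
-/

set_option linter.dupNamespace false -- mandated namespace of this single-conjunct summit

noncomputable section

open CategoryTheory CategoryTheory.Limits AlgebraicGeometry Literature.AlgebraicGeometry.Resolution
open IsLocalRing TopologicalSpace HomogeneousLocalization Scheme.IdealSheafData
open Literature.AlgebraicGeometry.Motives Literature.AlgebraicGeometry.Motives.ProjBaseChangeRing
open Summit.ResolutionOfSingularities.ResolutionOfSingularities.Cruxes.EquisingularLiftNat.Sections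

namespace Summit.ResolutionOfSingularities.ResolutionOfSingularities.Theorems.DepthTargets

universe u

set_option maxHeartbeats 800000 in
/-- **R5ᴴ N1 — THE INITIAL HYPERSURFACE-LED PACKAGE: `HLedInitial` holds.** For `S` complete regular local of dimension four with a
coefficient field, `x` generators of `𝔪`, a one-form member of depth `ℓ ≥ 1` with leading form `P₀ ≠ 0` of degree `d ≥ 1`, next form
`P₁`, remainder `G ∈ 𝔪^{d+2}`, `(f)` prime and `(P₀, P₁)` hypersurface-led, the member ideal `(f) + (x_k^{d+ℓ})` has an `HLedPackage`:
`X = Bl_𝔪 Spec S`, carrier `W = V(((f)𝒪 : 𝓘_Eᵈ))` the strict transform of `V(f)` — regular (flag criterion on `E`, spread by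
properness), integral of dimension three (blow-up of `Spec (S ⧸ (f))`), Noetherian, excellent — boundary `[(𝓘_E, ℓ)]` with `𝓘_E|_W` a
proper effective Cartier divisor, format `I𝒪_X = 𝓘_Eᵈ (𝓗 ⊔ 𝓘_E^ℓ)`. [cite: KawanoueMatsuki2016, §2] [cite: Matsumura1987, Thm. 14.2]
[cite: Kollar2007, (3.111) Step 3] [cite: BierstoneGrigorievMilmanWlodarczyk2011, §4 Remark (3)] [cite: StacksProject, Tag 07QW] -/
theorem hLedInitial : HLedInitial.{u} := by
  intro S _ _ _ hdim κ₀ _ σ hσ x hx d ℓ P₀ hP₀ P₁ hP₁ G hG hP00 hd1 hℓ hprime hled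
  letI : Algebra κ₀ S := σ.toAlgebra
  -- the standard gradings of the polynomial rings (Mathlib `def`s), switched on inside this proof only
  letI : GradedAlgebra (MvPolynomial.homogeneousSubmodule (Fin (3 + 1)) S) := MvPolynomial.gradedAlgebra
  letI : GradedAlgebra (MvPolynomial.homogeneousSubmodule (Fin (3 + 1)) κ₀) := MvPolynomial.gradedAlgebra
  haveI : IsDomain S := isDomain_of_isRegularLocalRing S
  have hd : (IsLocalRing.maximalIdeal S).spanFinrank = 3 + 1 := by
    have h := IsRegularLocalRing.spanFinrank_maximalIdeal (R := S)
    rw [hdim] at h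
    exact_mod_cast h
  have hqr : IsQuasiRegular x := isQuasiRegular_regularSystemOfParameters hd x hx
  have hκ := DepthOne.bijective_algebraMap_quotient_of_coefficientField x hx σ hσ
  haveI := DepthOne.isIso_subschemeι_comp_retraction₀ x κ₀ hqr hκ
  haveI : IsNoetherian (affineBlowup (Ideal.span (Set.range x))) :=
    isNoetherian_of_isBlowup (affineBlowup.isBlowup (Ideal.span (Set.range x)))
  haveI : IsProper (affineBlowup.π (Ideal.span (Set.range x))) := (affineBlowup.isBlowup _).isProper
  -- notation
  set 𝓔 := (affineBlowup.idealSheaf (Ideal.span (Set.range x))).comap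
    (affineBlowup.π (Ideal.span (Set.range x))) with h𝓔
  set R₀ : affineBlowup (Ideal.span (Set.range x)) ⟶ ProjSpace.P 3 κ₀ :=
    Proj.map (reesPresentation x) (irrelevant_le_map_reesPresentation x) ≫
      Proj.map (mapGraded κ₀ S (Fin (3 + 1))) (irrelevant_le_map κ₀ S (Fin (3 + 1))) with hR₀
  set iE : ProjSpace.P 3 κ₀ ⟶ affineBlowup (Ideal.span (Set.range x)) := inv (𝓔.subschemeι ≫ R₀) ≫ 𝓔.subschemeι with hiE
  have hiR : iE ≫ R₀ = 𝟙 _ := by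
    rw [hiE, Category.assoc]; exact IsIso.inv_hom_id _
  have hker : iE.ker = 𝓔 := by
    rw [hiE, Scheme.Hom.ker_comp_of_isIso, Scheme.IdealSheafData.ker_subschemeι]
  have hcart : IsEffectiveCartier 𝓔 := (affineBlowup.isBlowup (Ideal.span (Set.range x))).isEffectiveCartier
  have hV : Scheme.IsRegular (affineBlowup (Ideal.span (Set.range x))) := DepthOne.isRegular_blowup x hx
  have hPm : Scheme.IsRegular (ProjSpace.P 3 κ₀) :=
    Scheme.IsRegular.of_iso (𝓔.subschemeι ≫ R₀) (DepthOne.isRegular_exceptional x hx hd)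
  -- the generator through the coefficient field
  set f : Fin 1 → S := fun l => MvPolynomial.aeval x (P₀ l) + MvPolynomial.aeval x (P₁ l) + G l with hf
  have hfun : (fun l => MvPolynomial.eval₂Hom σ x (P₀ l) + MvPolynomial.eval₂Hom σ x (P₁ l) + G l) = f := by
    funext l
    simp only [hf, MvPolynomial.coe_eval₂Hom, MvPolynomial.aeval_def, RingHom.algebraMap_toAlgebra]
  have hf0eq : MvPolynomial.eval₂Hom σ x (P₀ 0) + MvPolynomial.eval₂Hom σ x (P₁ 0) + G 0 = f 0 := congr_fun hfun 0
  have hG' : ∀ l, G l ∈ Ideal.span (Set.range x) ^ (d + 2) := fun l => by rw [hx]; exact hG l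
  -- `f 0 ≠ 0` (the form `P₀ 0 ≠ 0` survives modulo `𝔪^{d+1}`)
  have hf0 : f 0 ≠ 0 := by
    intro h0
    have h1 : MvPolynomial.aeval x (P₁ 0) ∈ IsLocalRing.maximalIdeal S ^ (d + 1) := by
      rw [MvPolynomial.aeval_def, RingHom.algebraMap_toAlgebra, ← MvPolynomial.coe_eval₂Hom, ← hx]
      exact eval₂Hom_mem_span_pow_of_isHomogeneous σ x ((MvPolynomial.mem_homogeneousSubmodule _ _).mp (hP₁ 0))
    have h2 : G 0 ∈ IsLocalRing.maximalIdeal S ^ (d + 1) := Ideal.pow_le_pow_right (Nat.le_succ _) (hG 0)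
    have h3 : MvPolynomial.eval₂Hom σ x (P₀ 0) ∈ IsLocalRing.maximalIdeal S ^ (d + 1) := by
      have : MvPolynomial.eval₂Hom σ x (P₀ 0) = -(MvPolynomial.aeval x (P₁ 0) + G 0) := by
        have e : MvPolynomial.aeval x (P₀ 0) + MvPolynomial.aeval x (P₁ 0) + G 0 = 0 := h0
        rw [MvPolynomial.coe_eval₂Hom, ← RingHom.algebraMap_toAlgebra (i := σ), ← MvPolynomial.aeval_def]
        linear_combination e
      rw [this]
      exact neg_mem (add_mem h1 h2)
    exact eval₂Hom_form_not_mem_pow_succ hd σ hσ x hx ((MvPolynomial.mem_homogeneousSubmodule _ _).mp (hP₀ 0))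
      hP00 h3
  -- `(f)𝒪 ≤ 𝓘_Eᵈ`
  have hfM : Ideal.span (Set.range f) ≤ Ideal.span (Set.range x) ^ d := by
    refine Ideal.span_le.mpr ?_
    rintro _ ⟨l, rfl⟩
    have h0 : MvPolynomial.aeval x (P₀ l) ∈ Ideal.span (Set.range x) ^ d := by
      rw [MvPolynomial.aeval_def, RingHom.algebraMap_toAlgebra, ← MvPolynomial.coe_eval₂Hom]
      exact eval₂Hom_mem_span_pow_of_isHomogeneous σ x ((MvPolynomial.mem_homogeneousSubmodule _ _).mp (hP₀ l))
    have h1 : MvPolynomial.aeval x (P₁ l) ∈ Ideal.span (Set.range x) ^ d := by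
      rw [MvPolynomial.aeval_def, RingHom.algebraMap_toAlgebra, ← MvPolynomial.coe_eval₂Hom]
      exact Ideal.pow_le_pow_right (Nat.le_succ d)
        (eval₂Hom_mem_span_pow_of_isHomogeneous σ x ((MvPolynomial.mem_homogeneousSubmodule _ _).mp (hP₁ l)))
    exact add_mem (add_mem h0 h1) (Ideal.pow_le_pow_right (by omega) (hG' l))
  have hspan : Ideal.span (Set.range f) = Ideal.span {f 0} := by
    rw [Set.range_unique]; rfl
  have hf0m : f 0 ∈ IsLocalRing.maximalIdeal S := by
    rw [← hx]
    exact Ideal.pow_le_self (by omega) (hfM (Ideal.subset_span ⟨0, rfl⟩))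
  have hL : (affineBlowup.idealSheaf (Ideal.span (Set.range f))).comap
      (affineBlowup.π (Ideal.span (Set.range x))) ≤ 𝓔 ^ d := by
    rw [h𝓔, ← comap_pow, ← DepthOne.idealSheaf_pow]
    exact Scheme.IdealSheafData.comap_mono _ (idealSheaf_mono hfM)
  set 𝓗 := colon ((affineBlowup.idealSheaf (Ideal.span (Set.range f))).comap
      (affineBlowup.π (Ideal.span (Set.range x)))) (𝓔 ^ d) with h𝓗
  set K := 𝓗 ⊔ 𝓔 ^ 2 with hK
  -- the host is an effective Cartier divisor: `𝓘_Eᵈ · 𝓗 = (f)𝒪` with `f ≠ 0`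
  have hHfmt : 𝓔 ^ d * 𝓗 = (affineBlowup.idealSheaf (Ideal.span (Set.range f))).comap
      (affineBlowup.π (Ideal.span (Set.range x))) := pow_mul_colon_eq_of_le hcart hL
  have hHcart : IsEffectiveCartier 𝓗 := by
    refine IsEffectiveCartier.of_mul_right (I := 𝓔 ^ d) ?_
    rw [hHfmt, hspan]
    exact (affineBlowup.isEffectiveCartier_idealSheaf_span_singleton
      (mem_nonZeroDivisors_of_ne_zero hf0)).comap_of_isBlowup (affineBlowup.isBlowup _)
  -- the FORMAT `I𝒪 = 𝓘_Eᵈ · (𝓗 ⊔ 𝓘_E^ℓ)`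
  have hfmt : (affineBlowup.idealSheaf (oneFormMemberIdeal σ x d ℓ P₀ P₁ G)).comap
      (affineBlowup.π (Ideal.span (Set.range x))) = 𝓔 ^ d * (𝓗 ⊔ 𝓔 ^ ℓ) := by
    rw [oneFormMemberIdeal, hfun, idealSheaf_sup_eq, Scheme.IdealSheafData.comap_sup,
      DepthOne.comap_idealSheaf_span_powers_eq_pow x rfl (affineBlowup.isBlowup _) (by omega : 1 ≤ d + ℓ), ← h𝓔]
    simp only [← Scheme.IdealSheafData.add_eq_sup]
    rw [mul_add, hHfmt, ← pow_add]
  -- the coefficient flag of `K = 𝓗 ⊔ 𝓘_E²` is `(𝓟(P₀), 𝓟(P₀) ⊔ 𝓟(P₁))`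
  obtain ⟨h0, h1⟩ := DepthOne.coeffFlag_residual_eq x κ₀ P₀ P₁ hP₀ hP₁ G hG' hL K (by rw [hK, h𝓗])
  have hb := projIdealSheaf_single_ne_bot_and_isLocallyPrincipal κ₀ 3 d P₀ hP₀ hP00
  have hKi : K.comap iE = formsIdealSheaf κ₀ 3 d P₀ hP₀ := h0
  -- `𝓗|_E = 𝓟(P₀)`, an effective Cartier divisor of `E ≅ ℙ³`
  have h𝓗E : 𝓗.comap iE = formsIdealSheaf κ₀ 3 d P₀ hP₀ := by
    rw [← hKi, hK, Scheme.IdealSheafData.comap_sup, ← hker, comap_pow, comap_ker_self, ← zero_eq_bot,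
      zero_pow two_ne_zero, zero_eq_bot, sup_bot_eq]
  have hPE : IsEffectiveCartier (𝓗.comap iE) := by
    rw [h𝓗E]; exact hb.2.isEffectiveCartier_of_ne_bot hb.1
  have hE𝓗 : IsEffectiveCartier (𝓗.comap 𝓔.subschemeι) := by
    have h := hPE.comap_iso (asIso (𝓔.subschemeι ≫ R₀))
    rwa [asIso_hom, ← Scheme.IdealSheafData.comap_comp, hiE, IsIso.hom_inv_id_assoc] at h
  -- `𝓘_E|_W` is an effective Cartier divisor
  have hEW : IsEffectiveCartier (𝓔.comap 𝓗.subschemeι) := isEffectiveCartier_comap_subschemeι_swap hcart hHcart hE𝓗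
  -- points over the closed point lie on `E`
  have hoverE : ∀ y : ↥(affineBlowup (Ideal.span (Set.range x))),
      (affineBlowup.π (Ideal.span (Set.range x))).base y = closedPoint S → ∃ e : ProjSpace.P 3 κ₀, iE.base e = y := by
    intro y hy
    have h1 : y ∈ (𝓔.support : Set _) := by
      rw [h𝓔, support_comap, Closeds.coe_preimage, affineBlowup.support_idealSheaf, Set.mem_preimage]
      rw [hy]
      refine (PrimeSpectrum.mem_zeroLocus (closedPoint S) _).mpr ?_
      rw [hx]
      exact subset_rfl
    rw [← Scheme.IdealSheafData.range_subschemeι] at h1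
    obtain ⟨z, rfl⟩ := h1
    refine ⟨(𝓔.subschemeι ≫ R₀).base z, ?_⟩
    show ((𝓔.subschemeι ≫ R₀) ≫ iE).base z = _
    rw [hiE, IsIso.hom_inv_id_assoc]
  -- the flag has order `≤ 1` everywhere on `E` (hypersurface-led)
  have hflag : ∀ e : ProjSpace.P 3 κ₀,
      idealOrder (DepthGraded.coeffFlag iE R₀ 0 K ⊔ DepthGraded.coeffFlag iE R₀ 1 K ^ 2) e ≤ 1 := by
    intro e
    rw [h0, h1]
    rcases hled e with h | h
    · by_contra hc
      have h2 := DepthFlag.two_le_of_not_le_one hc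
      rw [show (2 : ℕ∞) = ((2 : ℕ) : ℕ∞) from rfl, DepthFlag.le_idealOrder_sup_iff] at h2
      have h3 : ((2 : ℕ) : ℕ∞) ≤ 1 := h2.1.trans h
      exact absurd h3 (by decide)
    · have he : e ∉ ((formsIdealSheaf κ₀ 3 d P₀ hP₀ ⊔
          (formsIdealSheaf κ₀ 3 d P₀ hP₀ ⊔ formsIdealSheaf κ₀ 3 (d + 1) P₁ hP₁) ^ 2).support : Set _) := by
        intro hmem
        have h3 : e ∈ (((formsIdealSheaf κ₀ 3 d P₀ hP₀ ⊔ formsIdealSheaf κ₀ 3 (d + 1) P₁ hP₁) ^ 2).support : Set _) :=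
          support_antitone (le_sup_right (a := formsIdealSheaf κ₀ 3 d P₀ hP₀)) hmem
        rw [support_pow _ _ two_ne_zero] at h3
        have h4 : e ∈ ((formsIdealSheaf κ₀ 3 (d + 1) P₁ hP₁).support : Set _) :=
          support_antitone (le_sup_right (a := formsIdealSheaf κ₀ 3 d P₀ hP₀)) h3
        exact ((idealOrder_eq_zero_iff_not_mem_support _ e).mp h) h4
      rw [(idealOrder_eq_zero_iff_not_mem_support _ e).mpr he]
      exact zero_le_one
  -- `W = V(𝓗)` is regular: along `E` by the flag criterion, everywhere by properness over the local base
  have hWreg : Scheme.IsRegular 𝓗.subscheme := by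
    refine Scheme.isRegular_subscheme_of_forall_over_closedPoint (affineBlowup.π (Ideal.span (Set.range x))) 𝓗
      fun y hy𝓗 hy => ?_
    obtain ⟨e, rfl⟩ := hoverE y hy
    obtain ⟨F, -, hF, hF2⟩ := DepthFlag.exists_generator_host_not_mem_sq_of_flag iE R₀ hV hPm hiR
      (by rw [hker]; exact hcart) hHcart (K := K) (by rw [hker, hK]) e (hflag e)
    haveI : IsRegularLocalRing ((affineBlowup (Ideal.span (Set.range x))).presheaf.stalk (iE.base e)) := hV _
    have hFm : F ∈ maximalIdeal _ := by
      have hle := (mem_support_iff_stalkIdeal_le 𝓗 (iE.base e)).mp hy𝓗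
      rw [hF] at hle
      exact hle (Ideal.mem_span_singleton_self F)
    rw [hF]
    exact (IsRegularLocalRing.quotient_span_singleton hFm hF2).1
  -- `W → Spec (S ⧸ (f))` is the blow-up along `𝔪~`: `W` is integral of dimension three
  set k := Spec.map (CommRingCat.ofHom (Ideal.Quotient.mk (Ideal.span {f 0}))) with hk
  haveI : IsClosedImmersion k := IsClosedImmersion.spec_of_surjective _ Ideal.Quotient.mk_surjective
  have hkker : k.ker = affineBlowup.idealSheaf (Ideal.span {f 0}) := ker_specMap_quotient_mk _
  have hle : k.ker ≤ (𝓗.subschemeι ≫ affineBlowup.π (Ideal.span (Set.range x))).ker := by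
    rw [hkker, le_ker_iff_comap_eq_bot, Scheme.IdealSheafData.comap_comp, ← hspan, ← hHfmt, comap_mul,
      comap_subschemeι_self, mul_bot]
  set πS := IsClosedImmersion.lift k (𝓗.subschemeι ≫ affineBlowup.π (Ideal.span (Set.range x))) hle with hπSdef
  have hπS : πS ≫ k = 𝓗.subschemeι ≫ affineBlowup.π (Ideal.span (Set.range x)) := IsClosedImmersion.lift_fac _ _ _
  have hbl : IsBlowup πS ((affineBlowup.idealSheaf (Ideal.span (Set.range x))).comap k) :=
    IsBlowup.isBlowup_subscheme_of_pow_mul_eq (affineBlowup.isBlowup (Ideal.span (Set.range x))) k (Q := 𝓗) (μ := d)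
      (by rw [hkker, ← hspan]; exact hHfmt) hEW πS hπS
  haveI : (Ideal.span {f 0}).IsPrime := by rw [← hf0eq]; exact hprime
  haveI : IsDomain (S ⧸ Ideal.span {f 0}) := Ideal.Quotient.isDomain _
  have h3 : ringKrullDim (S ⧸ Ideal.span {f 0}) = (3 : ℕ) := by
    rw [DepthLegal.ringKrullDim_quotient_span_singleton_eq hdim hf0m hf0]
  have hCk : (affineBlowup.idealSheaf (Ideal.span (Set.range x))).comap k ≠ ⊥ := by
    rw [hk, affineBlowup.comap_idealSheaf_specMap]
    refine affineBlowup.idealSheaf_ne_bot ?_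
    intro h0
    rw [Ideal.map_eq_bot_iff_le_ker, Ideal.mk_ker, hx] at h0
    have heq : Ideal.span {f 0} = maximalIdeal S := le_antisymm ((Ideal.span_singleton_le_iff_mem _).mpr hf0m) h0
    haveI : (Ideal.span {f 0}).IsMaximal := heq ▸ IsLocalRing.maximalIdeal.isMaximal S
    letI := Ideal.Quotient.field (Ideal.span {f 0})
    have hzero : ringKrullDim (S ⧸ Ideal.span {f 0}) = 0 := ringKrullDim_eq_zero_of_field _
    rw [hzero] at h3
    exact absurd h3 (by norm_num)
  haveI : IsIntegral 𝓗.subscheme := hbl.isIntegral hCk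
  haveI : IsNoetherian 𝓗.subscheme := isNoetherian_subscheme 𝓗
  haveI : IsProper πS := hbl.isProper
  have hY : topologicalKrullDim ↥(Spec (.of (S ⧸ Ideal.span {f 0}))) = ringKrullDim (S ⧸ Ideal.span {f 0}) :=
    PrimeSpectrum.topologicalKrullDim_eq_ringKrullDim _
  have hdimW : topologicalKrullDim ↥𝓗.subscheme = 3 := by
    rw [(hbl.isBirational' hCk).topologicalKrullDim_eq_of_isProper, hY, h3]
    rfl
  -- `W` is excellent: of finite type over the complete, hence excellent, `S`
  have hexc : Scheme.IsExcellent 𝓗.subscheme :=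
    Scheme.IsExcellent.of_locallyOfFiniteType (𝓗.subschemeι ≫ affineBlowup.π (Ideal.span (Set.range x)))
      (Scheme.isExcellent_Spec_of_isExcellentRing S (isExcellentRing_of_isAdicComplete S))
  -- `𝓘_E|_W ≠ ⊤`: the non-empty proper `S`-scheme `W` has a point over the closed point
  have hEWtop : 𝓔.comap 𝓗.subschemeι ≠ ⊤ := by
    obtain ⟨w⟩ := (inferInstance : Nonempty ↥𝓗.subscheme)
    obtain ⟨w₀, -, hw₀⟩ := exists_specializes_over_closedPoint
      (𝓗.subschemeι ≫ affineBlowup.π (Ideal.span (Set.range x))) w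
    obtain ⟨e, he⟩ := hoverE (𝓗.subschemeι.base w₀) hw₀
    intro htop
    have hmem : w₀ ∈ ((𝓔.comap 𝓗.subschemeι).support : Set _) := by
      rw [support_comap, Closeds.coe_preimage, Set.mem_preimage, ← he, ← hker]
      exact (one_le_idealOrder_iff _ _).mp (DepthFlag.one_le_idealOrder_ker iE e)
    rw [htop, support_top] at hmem
    exact hmem
  -- the package
  refine ⟨𝓗.subscheme, affineBlowup (Ideal.span (Set.range x)), 𝓗.subschemeι, affineBlowup.π (Ideal.span (Set.range x)),
    𝓔, ℓ, hℓ, ?_, inferInstance, inferInstance, hexc, hdimW, hEW, hEWtop⟩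
  exact
    { isNoetherian := DepthOne.isNoetherian_blowup x
      isRegular := hV
      isRegular_host := hWreg
      isClosedImmersion := inferInstance
      isEffectiveCartier_ker := by rw [Scheme.IdealSheafData.ker_subschemeι]; exact hHcart
      exists_isBlowup_supported := ⟨_, affineBlowup.isBlowup (Ideal.span (Set.range x)),
        DepthOne.support_idealSheaf_span_subset x hx⟩
      boundary_cartier := fun p hp => by
        rw [List.mem_singleton] at hp
        subst hp
        exact hcart
      boundary_support := fun p hp y hy => by
        rw [List.mem_singleton] at hp
        subst hp
        have hy' : y ∈ Set.range 𝓔.subschemeι.base := by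
          rw [Scheme.IdealSheafData.range_subschemeι]; exact hy
        obtain ⟨e, rfl⟩ := hy'
        exact DepthOne.map_exceptional_eq_closedPoint x hx _
      exists_format := ⟨𝓔 ^ d, hcart.pow d, by
        rw [Scheme.IdealSheafData.ker_subschemeι, monomialIdeal_singleton]; exact hfmt⟩ }

end Summit.ResolutionOfSingularities.ResolutionOfSingularities.Theorems.DepthTargets

end
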